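import Summits.Ventures.PercRepro.C041TwoExitZone

/-!
# ROW C-041 — THE THREE-EXIT ATTACHMENT: an unmarked multigraph with zones hung at three of its vertices, and its
zone sets at the anchor (p6, gen 31; towards mine-3's three-exit cycle `thetaSq`, C-041.md §21 (ah), and the
general block map of §20 (c))

`glue3 Z₁ u u' u'' Z a Z' a' Z'' a''` hangs `Z'` at `u'` and `Z` at `u` (`glue2`, `C041TwoExitZone`) and then `Z''`
at `u''` — the anchor gluing of `C041AnchorGlue` once more, at the junction `inl (inl u'')` of the two-exit
attachment.  Every reach is inherited; the zone sets at the anchor `inl (inl (inl a₁))` read off the statuses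
(merged `Mg`, reached `Rd`) of the three exits and their pairwise blue connections inside `Z₁`:

* **`anchor_mem_D_iff`** / `anchor_mem_D2_iff` — deleted iff some exit is merged with its zone's anchor deleted;
* **`adm_iff`** — the three zones admissible, and neither junction deleted on both sides: the junction `u`
  collects the blue marks of `Z` and, through blue paths, those of `Z'`; the junction `u''` collects those of
  `Z''` and, through blue paths to `u` / `u'`, those of `Z` / `Z'`;
* **`blueK_iff`** — each reached exit's zone is blue at its own `K`.

The counts over the colourings (the fifteen status patterns of three exits: merged set × blue-connectivity of the
separated ones) are `C041ThreeExitCount` / `C041ThreeExitCountB`, the block map `C041ThreeExitMain`, the dictionary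
with mine-3's 81-case table `C041CycleDict3`.
-/

namespace PercRepro

namespace ZoneZ

namespace TwoExit

open ZoneData Pendant AnchorGlue

variable {V₁ E₁ U₁ U₂ V E T₁ T₂ V' E' T₁' T₂' V'' E'' T₁'' T₂'' : Type}
variable (Z₁ : ZoneData V₁ E₁ U₁ U₂) (u u' u'' : V₁) (Z : ZoneData V E T₁ T₂) (a : V)
  (Z' : ZoneData V' E' T₁' T₂') (a' : V') (Z'' : ZoneData V'' E'' T₁'' T₂'') (a'' : V'')

/-- THE THREE-EXIT ATTACHMENT: `Z'` at `u'`, `Z` at `u`, then `Z''` at `u''`. -/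
noncomputable abbrev glue3 :
    ZoneData (((V₁ ⊕ V') ⊕ V) ⊕ V'') (((E₁ ⊕ E') ⊕ E) ⊕ E'') ((T₁' ⊕ T₁) ⊕ T₁'') ((T₂' ⊕ T₂) ⊕ T₂'') :=
  glue (glue2 Z₁ u u' Z a Z' a') (Sum.inl (Sum.inl u'')) Z'' a''

variable (σ : State (((E₁ ⊕ E') ⊕ E) ⊕ E'') ((T₁' ⊕ T₁) ⊕ T₁'') ((T₂' ⊕ T₂) ⊕ T₂''))

/-- The colouring of `Z₁` in a state of the three-exit attachment. -/
def col₁₃ : E₁ → Bool := col₁ (restrL σ)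

/-- The state of `Z'`. -/
def st'₃ : State E' T₁' T₂' := st' (restrL σ)

/-- The state of `Z`. -/
def st₃ : State E T₁ T₂ := st (restrL σ)

/-- The state of `Z''`. -/
def st''₃ : State E'' T₁'' T₂'' := restrR σ

variable (a₁ : V₁)

/-- The red reach of the anchor at a `Z₁`-vertex of the two-exit attachment: the reach inside `Z₁`. -/
theorem mem_K_glue2_iff (τ : State ((E₁ ⊕ E') ⊕ E) (T₁' ⊕ T₁) (T₂' ⊕ T₂)) (v : V₁) :
    Sum.inl (Sum.inl v) ∈ (glue2 Z₁ u u' Z a Z' a').K {Sum.inl (Sum.inl a₁)} τ ↔ Z₁.Rd a₁ v (col₁ τ) := by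
  rw [inl_mem_K_iff_of_anchor, Pendant.inl_mem_K_iff]
  rfl

/-- The blue reach of the two-exit attachment from `inl (inl u'')`, at a `Z₁`-vertex: blue connectivity to `u''`
inside `Z₁` (the two zones add nothing). -/
theorem mem_P_glue2_iff (τ : State ((E₁ ⊕ E') ⊕ E) (T₁' ⊕ T₁) (T₂' ⊕ T₂)) (v : V₁) :
    Sum.inl (Sum.inl v) ∈ (glue2 Z₁ u u' Z a Z' a').P {Sum.inl (Sum.inl u'')} τ ↔ Z₁.Mg v u'' (col₁ τ) := by
  unfold P BlueAdj
  rw [adj_eq_cAdj, AnchorGlue.inl_mem_reach_iff (pendant Z₁ u' Z' a') (Sum.inl u) Z a false τ _ (by simp),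
    junction_singleton_iff_of_anchor]
  have e1 : leftSet ({Sum.inl (Sum.inl u'')} : Set ((V₁ ⊕ V') ⊕ V)) = {Sum.inl u''} := by
    ext x
    simp [leftSet]
  rw [e1]
  have h1 := inl_mem_P_junction_iff Z₁ u'' u' Z' a' τ v
  have h2 := inl_mem_P_junction_iff Z₁ u'' u' Z' a' τ u
  have h3 := inl_mem_P_junction_iff Z₁ u u' Z' a' τ v
  change (Sum.inl v ∈ (pendant Z₁ u' Z' a').P {Sum.inl u''} (restrL τ) ∨
    (Sum.inl u ∈ (pendant Z₁ u' Z' a').P {Sum.inl u''} (restrL τ) ∧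
      Sum.inl v ∈ (pendant Z₁ u' Z' a').P {Sum.inl u} (restrL τ))) ↔ _
  rw [h1, h2, h3]
  constructor
  · rintro (h | ⟨hu, hv⟩)
    · exact h
    · exact Mg_trans Z₁ _ _ _ _ hv hu
  · intro h
    exact Or.inl h

/-- The junction `u''` is deleted in the three-exit attachment iff `a''` is deleted in `Z''`, or `a'` is deleted
in `Z'` with `u''` blue-connected to `u'`, or `a` is deleted in `Z` with `u''` blue-connected to `u`. -/
theorem junction₃_mem_D_iff :
    Sum.inl (Sum.inl (Sum.inl u'')) ∈ (glue3 Z₁ u u' u'' Z a Z' a' Z'' a'').D σ ↔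
      (a' ∈ Z'.D (st'₃ σ) ∧ Z₁.Mg u'' u' (col₁₃ σ)) ∨ (a ∈ Z.D (st₃ σ) ∧ Z₁.Mg u'' u (col₁₃ σ)) ∨
        a'' ∈ Z''.D (st''₃ σ) := by
  rw [AnchorGlue.inl_a_mem_D_iff, anchor_mem_D_iff, or_assoc]
  rfl

/-- The junction `u''` is deleted on side `2` iff `a''` is in `Z''`, or `a'` in `Z'` with `u'' ~ u'`, or `a` in
`Z` with `u'' ~ u`. -/
theorem junction₃_mem_D2_iff :
    Sum.inl (Sum.inl (Sum.inl u'')) ∈ (glue3 Z₁ u u' u'' Z a Z' a' Z'' a'').D2 σ ↔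
      (a' ∈ Z'.D2 (st'₃ σ) ∧ Z₁.Mg u'' u' (col₁₃ σ)) ∨ (a ∈ Z.D2 (st₃ σ) ∧ Z₁.Mg u'' u (col₁₃ σ)) ∨
        a'' ∈ Z''.D2 (st''₃ σ) := by
  rw [AnchorGlue.inl_a_mem_D2_iff, anchor_mem_D2_iff, or_assoc]
  rfl

/-- **The anchor is deleted** iff some exit is merged with its zone's anchor deleted. -/
theorem anchor₃_mem_D_iff :
    Sum.inl (Sum.inl (Sum.inl a₁)) ∈ (glue3 Z₁ u u' u'' Z a Z' a' Z'' a'').D σ ↔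
      (a' ∈ Z'.D (st'₃ σ) ∧ Z₁.Mg a₁ u' (col₁₃ σ)) ∨ (a ∈ Z.D (st₃ σ) ∧ Z₁.Mg a₁ u (col₁₃ σ)) ∨
        (a'' ∈ Z''.D (st''₃ σ) ∧ Z₁.Mg a₁ u'' (col₁₃ σ)) := by
  rw [AnchorGlue.inl_mem_D_iff, junction₃_mem_D_iff, anchor_mem_D_iff, mem_P_glue2_iff]
  unfold st'₃ st₃ col₁₃
  constructor
  · rintro (h | ⟨(⟨hD', hc⟩ | ⟨hD, hc⟩ | hD''), hm⟩)
    · rcases h with h | h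
      · exact Or.inl h
      · exact Or.inr (Or.inl h)
    · exact Or.inl ⟨hD', Mg_trans Z₁ _ _ _ _ hm hc⟩
    · exact Or.inr (Or.inl ⟨hD, Mg_trans Z₁ _ _ _ _ hm hc⟩)
    · exact Or.inr (Or.inr ⟨hD'', hm⟩)
  · rintro (h | h | ⟨hD'', hm⟩)
    · exact Or.inl (Or.inl h)
    · exact Or.inl (Or.inr h)
    · exact Or.inr ⟨Or.inr (Or.inr hD''), hm⟩

/-- **The anchor is deleted on side `2`** iff some exit is merged with its zone's anchor deleted on side `2`. -/
theorem anchor₃_mem_D2_iff :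
    Sum.inl (Sum.inl (Sum.inl a₁)) ∈ (glue3 Z₁ u u' u'' Z a Z' a' Z'' a'').D2 σ ↔
      (a' ∈ Z'.D2 (st'₃ σ) ∧ Z₁.Mg a₁ u' (col₁₃ σ)) ∨ (a ∈ Z.D2 (st₃ σ) ∧ Z₁.Mg a₁ u (col₁₃ σ)) ∨
        (a'' ∈ Z''.D2 (st''₃ σ) ∧ Z₁.Mg a₁ u'' (col₁₃ σ)) := by
  rw [AnchorGlue.inl_mem_D2_iff, junction₃_mem_D2_iff, anchor_mem_D2_iff, mem_P_glue2_iff]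
  unfold st'₃ st₃ col₁₃
  constructor
  · rintro (h | ⟨(⟨hD', hc⟩ | ⟨hD, hc⟩ | hD''), hm⟩)
    · rcases h with h | h
      · exact Or.inl h
      · exact Or.inr (Or.inl h)
    · exact Or.inl ⟨hD', Mg_trans Z₁ _ _ _ _ hm hc⟩
    · exact Or.inr (Or.inl ⟨hD, Mg_trans Z₁ _ _ _ _ hm hc⟩)
    · exact Or.inr (Or.inr ⟨hD'', hm⟩)
  · rintro (h | h | ⟨hD'', hm⟩)
    · exact Or.inl (Or.inl h)
    · exact Or.inl (Or.inr h)
    · exact Or.inr ⟨Or.inr (Or.inr hD''), hm⟩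

/-- **Admissibility of the three-exit attachment**: the three zones admissible, the junction `u` (collecting the
blue marks of `Z` and, through a blue path to `u'`, those of `Z'`) not deleted on both sides, and the junction
`u''` (collecting those of `Z''` and, through blue paths to `u'` / `u`, those of `Z'` / `Z`) not deleted on both
sides. -/
theorem adm₃_iff :
    (glue3 Z₁ u u' u'' Z a Z' a' Z'' a'').adm σ ↔
      Z'.adm (st'₃ σ) ∧ Z.adm (st₃ σ) ∧ Z''.adm (st''₃ σ) ∧
        ¬ (((a' ∈ Z'.D (st'₃ σ) ∧ Z₁.Mg u u' (col₁₃ σ)) ∨ a ∈ Z.D (st₃ σ)) ∧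
          ((a' ∈ Z'.D2 (st'₃ σ) ∧ Z₁.Mg u u' (col₁₃ σ)) ∨ a ∈ Z.D2 (st₃ σ))) ∧
        ¬ (((a' ∈ Z'.D (st'₃ σ) ∧ Z₁.Mg u'' u' (col₁₃ σ)) ∨ (a ∈ Z.D (st₃ σ) ∧ Z₁.Mg u'' u (col₁₃ σ)) ∨
            a'' ∈ Z''.D (st''₃ σ)) ∧
          ((a' ∈ Z'.D2 (st'₃ σ) ∧ Z₁.Mg u'' u' (col₁₃ σ)) ∨ (a ∈ Z.D2 (st₃ σ) ∧ Z₁.Mg u'' u (col₁₃ σ)) ∨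
            a'' ∈ Z''.D2 (st''₃ σ))) := by
  rw [AnchorGlue.adm_iff, adm_iff, junction₃_mem_D_iff, junction₃_mem_D2_iff]
  unfold st'₃ st₃ st''₃ col₁₃
  tauto

/-- **Blue at `K` at the anchor**: each reached exit's zone is blue at its own `K`. -/
theorem blueK₃_iff :
    (glue3 Z₁ u u' u'' Z a Z' a' Z'' a'').blueK {Sum.inl (Sum.inl (Sum.inl a₁))} σ ↔
      (Z₁.Rd a₁ u' (col₁₃ σ) → Z'.blueK {a'} (st'₃ σ)) ∧ (Z₁.Rd a₁ u (col₁₃ σ) → Z.blueK {a} (st₃ σ)) ∧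
        (Z₁.Rd a₁ u'' (col₁₃ σ) → Z''.blueK {a''} (st''₃ σ)) := by
  rw [blueK_iff_of_anchor, blueK_iff, mem_K_glue2_iff]
  unfold st'₃ st₃ st''₃ col₁₃
  rw [and_assoc]

end TwoExit

end ZoneZ

end PercRepro
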